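import Mathlib
import HarnessLib

/-!
# `NoHeavyLowerTail` (stmt-CriticalPhenomena-4575) — class odds: a glued class carries at least its weight `t_X = Θ_X/(1−Θ_X)`

Support file (prover `prim-gen-swap` gen 11; `--supports stmt-CriticalPhenomena-4575`).  No definitions, no named facts, no sorries.

Lemma L1.1 of the seat memo U1-PROOF.md (the word budget at class level, used throughout the proof of the r-avoiding MWF supply
inequality U1′_r).  In the extreme coefficients of `StarSet.extreme_regroup` — star `i` with hairs `β_i, β'_i ∈ [0,1]`, `θ_i = β_iβ'_i`,
`a_i(0) = (1−β)(1−β')/(1−θ)` (unglued), `a_i(1) = β(1−β')/(1−θ)` (glued to the first port) — one has, star by star,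
`(1 − θ_i)·(a_i(0) + a_i(1)) ≥ a_i(0)` (because `β ≥ θ`), hence for a class `X` (a finite set of stars)
`Π_{i∈X}(1−θ_i) · Π_{i∈X}(a_i(0)+a_i(1)) ≥ Π_{i∈X} a_i(0)` and
`Π_{i∈X}(1−θ_i) · (Π_{i∈X}(a_i(0)+a_i(1)) − Π_{i∈X} a_i(0)) ≥ (1 − Π_{i∈X}(1−θ_i)) · Π_{i∈X} a_i(0)`:
the hair patterns in which the stars of `X` are unglued or glued to the same port, not all unglued, weigh at least `t_X` times the
all-unglued pattern ("O_{X,d} ≥ t_X").  The second-port versions follow by swapping `β, β'`.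

* `StarSet.coeffZero_le_oneSubTheta_mul_sum`, `StarSet.coeffZero_le_oneSubTheta_mul_sum'` (one star, first / second port);
* `StarSet.prod_coeffZero_le_classOdds`, `StarSet.classWeight_mul_prod_coeffZero_le` (a class).
-/

namespace Summit.CriticalPhenomena.PercolationContinuityZ3.Theorems

open Finset
open scoped BigOperators

namespace StarSet

/-- **One star, first port: `(1−θ)(a(0)+a(1)) ≥ a(0)`.**  Extreme coefficients as in `StarSet.extreme_regroup`. [U1-PROOF.md L1.1] -/
theorem coeffZero_le_oneSubTheta_mul_sum (β β' : ℝ) (hβ0 : 0 ≤ β) (hβ1 : β ≤ 1) (_hβ'0 : 0 ≤ β') (hβ'1 : β' ≤ 1) :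
    (if β * β' < 1 then ((1 - β) * (1 - β')) / (1 - β * β') else (0 : ℝ)) ≤
      (1 - β * β') * ((if β * β' < 1 then ((1 - β) * (1 - β')) / (1 - β * β') else (0 : ℝ)) +
        (if β * β' < 1 then (β * (1 - β')) / (1 - β * β') else (1 : ℝ))) := by
  by_cases h : β * β' < 1
  · have hpos : 0 < 1 - β * β' := by linarith
    simp only [if_pos h]
    rw [← add_div, mul_div_cancel₀ _ (ne_of_gt hpos), div_le_iff₀ hpos]
    -- `(1−β)(1−β') ≤ ((1−β)(1−β') + β(1−β'))·(1−ββ') = (1−β')(1−ββ')` since `β ≥ ββ'`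
    have h1 : (1 - β) * (1 - β') + β * (1 - β') = 1 - β' := by ring
    rw [h1]
    have hβθ : β * β' ≤ β := by nlinarith
    nlinarith
  · simp only [if_neg h]
    have : β * β' = 1 := le_antisymm (by nlinarith) (not_lt.1 h)
    rw [this]; norm_num

/-- **One star, second port: `(1−θ)(a(0)+a(2)) ≥ a(0)`.** [U1-PROOF.md L1.1] -/
theorem coeffZero_le_oneSubTheta_mul_sum' (β β' : ℝ) (hβ0 : 0 ≤ β) (hβ1 : β ≤ 1) (hβ'0 : 0 ≤ β') (hβ'1 : β' ≤ 1) :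
    (if β * β' < 1 then ((1 - β) * (1 - β')) / (1 - β * β') else (0 : ℝ)) ≤
      (1 - β * β') * ((if β * β' < 1 then ((1 - β) * (1 - β')) / (1 - β * β') else (0 : ℝ)) +
        (if β * β' < 1 then ((1 - β) * β') / (1 - β * β') else (0 : ℝ))) := by
  by_cases h : β * β' < 1
  · have hpos : 0 < 1 - β * β' := by linarith
    simp only [if_pos h]
    rw [← add_div, mul_div_cancel₀ _ (ne_of_gt hpos), div_le_iff₀ hpos]
    have h1 : (1 - β) * (1 - β') + (1 - β) * β' = 1 - β := by ring
    rw [h1]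
    have hβθ : β * β' ≤ β' := by nlinarith
    nlinarith
  · simp only [if_neg h]
    have : β * β' = 1 := le_antisymm (by nlinarith) (not_lt.1 h)
    rw [this]; norm_num

/-- **A class: `Π(1−θ_i)·Π(a_i(0)+g_i) ≥ Π a_i(0)`** whenever star by star `a_i(0) ≤ (1−θ_i)(a_i(0)+g_i)` with `a_i(0) ≥ 0`
(apply with `g_i = a_i(1)` or `a_i(2)` via the two lemmas above). [U1-PROOF.md L1.1] -/
theorem prod_coeffZero_le_classOdds {ι : Type*} (X : Finset ι) (θ a0 g : ι → ℝ)
    (ha0 : ∀ i ∈ X, 0 ≤ a0 i) (hstar : ∀ i ∈ X, a0 i ≤ (1 - θ i) * (a0 i + g i)) :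
    ∏ i ∈ X, a0 i ≤ (∏ i ∈ X, (1 - θ i)) * ∏ i ∈ X, (a0 i + g i) := by
  rw [← prod_mul_distrib]
  exact prod_le_prod (fun i hi => ha0 i hi) (fun i hi => hstar i hi)

/-- **A class carries at least its weight: `Π(1−θ_i)·(Π(a_i(0)+g_i) − Π a_i(0)) ≥ (1 − Π(1−θ_i))·Π a_i(0)`**, i.e. the mass of the
patterns "every star of `X` unglued or glued to the chosen port, not all unglued" is at least `t_X = Θ_X/(1−Θ_X)` times the all-unglued
mass, in the multiplied-out form that needs no division. [U1-PROOF.md L1.1, "O_{X,d} ≥ t_X"] -/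
theorem classWeight_mul_prod_coeffZero_le {ι : Type*} (X : Finset ι) (θ a0 g : ι → ℝ)
    (ha0 : ∀ i ∈ X, 0 ≤ a0 i) (hstar : ∀ i ∈ X, a0 i ≤ (1 - θ i) * (a0 i + g i)) :
    (1 - ∏ i ∈ X, (1 - θ i)) * ∏ i ∈ X, a0 i ≤
      (∏ i ∈ X, (1 - θ i)) * ((∏ i ∈ X, (a0 i + g i)) - ∏ i ∈ X, a0 i) := by
  have h := prod_coeffZero_le_classOdds X θ a0 g ha0 hstar
  nlinarith [h]

end StarSet

end Summit.CriticalPhenomena.PercolationContinuityZ3.Theorems
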